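import Summits.HodgeConjecture.HodgeConjecture.Theorems.F0P3cStCharTSUpTrExchange     -- ★ (A1′)-D p852501: `map_continuousMulEquiv_eq_of_apply_compactCore_eq_one`; brings ★ `F0P3cStCharTSWeylCartanRadial` (`centralizer_eq_cartan_of_isRegularElt`, …)
import Literature.GroupTheory.CentralizerConjugatesTorsor                              -- ★ (H6-T) p852394: `ncard_setOf_mem_isConj_eq_index` (the torsor count)
import Summits.HodgeConjecture.HodgeConjecture.Theorems.F0P3cStCharTSUpTrCover            -- ★ (H3e) p852372: `mem_centralizer_conj_iff` (`Z_G(c z c⁻¹)` in membership letters)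
import HarnessLib

/-!
# F0 · P3c · line LH6 «StCharTS» — road «ELL-INNER» (census `F0/P3b/LH6-p03/g7/CENSUS-1252-ELL-INNER.v1.LH6p03g7.md`, desk F0P3-plan (g18) word 2026-09-02T19:53:05Z
# «ROAD AFTER UP-TR»), brick (E0a) «TORUS EXCHANGE»: the elliptic torus sum `Σ_{T′ ∈ Sell} |W_G(T′)|⁻¹ ∫_{T′}` COUNTS EACH REGULAR CLASS ONCE — read along ONE embedding
# `e : T_H ≃ₜ* Z_G(γ)` of a compact `H_v`-Cartan (Rogawski 1990 §12.5 p. 182 «the number of `δ` such that `T^δ` is conjugate to `T₁` is `|Ω_F(T,G)|∕|Ω(T₁,G)|`»;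
# Harish-Chandra 1970 Lemma 42)

Cell `pub/hodgecm-mathlib`, crux H413 = `stmt-HodgeConjecture-24833` (lane `--supports … --as helper`, count-neutral), route HCCMUnconditional; seat LH6-p03 (g7), holder-designate of
«ELL-INNER» (LEAD F0P3a-plan (g15) T14-41 cc).  THEOREMS ONLY (no definition ∕ instance ∕ notation ∕ named fact ∕ `sorry`); ★-only imports; axioms TRIO.

THE MATHEMATICS.  `G = U(Φ₃)(L⁺_v)` (`v` non-split).  `Sell` = representatives of the conjugacy classes of ELLIPTIC Cartan subgroups of `G` in the lettering of ★ RUNG0 v8's `hBlock′`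
(`hcartO`: each member compact and `= Z_G(γ₀)`, `γ₀` regular; `hncGO`: distinct members not conjugate, Weyl-integration letters; `hHaarGO`∕`hcoreGO`: Haar measures `μTf T′` of mass
one on the compact core).  A topological-group isomorphism `e : T_H ≃ₜ* Z_G(γ)` from a subgroup `T_H` of any topological group (the ★ (X2) embeddings `eT T i` of an `H_v`-Cartan)
with `Z_G(γ)` conjugate INTO a member `T₀` (`∀ g, g ∈ Z_G(γ) ↔ y⁻¹ g y ∈ T₀` — ★ `hcovGO`'s letter), a Haar measure `tH` on `T_H` of mass one on its compact core, and a
conjugation-invariant `Φ : G → ℂ` vanishing off the regular set.  THEN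
  `Σ_{T′ ∈ Sell} ([N_G(T′):T′])⁻¹ · ∫_{x ∈ T′} #{s ∈ T_H ∣ e s ∼_G x} · Φ(x) dμTf T′ = ∫_{T_H} Φ(e s) dtH(s)`      (`sum_invIndex_mul_integral_ncard_mul_eq_integral_comp`).
Only the member `T₀` contributes (a regular `x ∈ T′` conjugate to some `e s` forces `T′ = Z_G(x) ∼ Z_G(e s) = Z_G(γ) ∼ T₀`, so `T′ = T₀` by `hncGO`); on `T₀` the count is the
TORSOR count `#{t ∈ T₀ ∣ t ∼ x} = [N_G(T₀):T₀]` (★ (H6-T), through the bijection `s ↦ y⁻¹ (e s) y : T_H → T₀`), cancelling the weight; and `∫_{T₀} Φ dμTf T₀ = ∫_{T_H} Φ ∘ e dtH`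
by transport along `s ↦ y⁻¹ (e s) y : T_H ≃ₜ* T₀` (★ (A1′)-D `map_continuousMulEquiv_eq_of_apply_compactCore_eq_one`, `Φ` a class function).  NO integrability hypothesis
(both sides are the same Bochner integral), NO `H_v`-structure on the source (any subgroup `T_H` of a topological group), NO regular-set bookkeeping (`Φ = 0` off the regular set
makes the pointwise identities hold everywhere).  This is the `(T, i)`-piece of (E0) «G-REGROUP» (sigsheet `F0/P3b/LH6-p03/g7/E0-GRegroup.sigsheet.v1.LH6p03g7.lean`): summed
over the ★ (X2) embedding family with the ★ (N5) pointwise fibre count it gives `Σ_{T′∈Sell} |W_G(T′)|⁻¹ ∫_{T′} Φ = Σ_{T∈SH} |W_H(T)|⁻¹ (m T)⁻¹ (cQ T)⁻¹ Σ_i ∫_T Φ∘eT T i`.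
* §1 `forall_mem_iff_of_conj` — conjugation into a member in membership letters (pure group algebra over ★ `mem_centralizer_conj_iff`);
* §2 `ncard_setOf_isConj_apply_eq_zero_of_ne` — OFF `T₀` the fibre of a regular `x ∈ T′` is empty; `ncard_setOf_isConj_apply_eq_index` — ON `T₀` it is the torsor;
* §3 `exists_conj_continuousMulEquiv` + `integral_eq_integral_comp_of_conj_into` — `∫_{T₀} Φ dμTf T₀ = ∫_{T_H} Φ ∘ e dtH`;
* §4 **`sum_invIndex_mul_integral_ncard_mul_eq_integral_comp`** — the head.
HONEST LABEL: count-neutral helper; closes no organ; `𝔇.Prop1252` stays a PRINTED consequent of `hBlock′` until a chartered road's ★ rider; HC_CM is proved only modulo the 7 printed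
citations (2 remaining named inputs: hLiu418 = `stmt-HodgeConjecture-24832`, h413 = `stmt-HodgeConjecture-24833`) until rung 0 closes.

## References
* [Rogawski1990] J. D. Rogawski, *Automorphic Representations of Unitary Groups in Three Variables*, Ann. of Math. Stud. 123 (1990): §12.5 pp. 182–184 (the `δ`-count p. 182, the
  first display p. 184, Prop. 12.5.2); §3.6 L. 3.6.1 p. 28; §3.7 Prop. 3.7.1 p. 29.
* [HarishChandra1970] Harish-Chandra (notes by G. van Dijk), *Harmonic analysis on reductive p-adic groups*, LNM 162 (1970), Part V §4 Lemma 42 (the torsor of conjugates in a Cartan).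
* [LanglandsShelstad1987] R. P. Langlands, D. Shelstad, *On the definition of transfer factors*, Math. Ann. 278 (1987), §1.3 (compatible measures on corresponding tori).
-/

set_option autoImplicit false
-- the mandated namespace has the single-problem summit's repeated segment (`HodgeConjecture.HodgeConjecture`)
set_option linter.dupNamespace false

noncomputable section

open MeasureTheory Measure Set Function NumberField IsDedekindDomain Matrix
open Literature.NumberTheory.Automorphic Literature.NumberTheory.Automorphic.UnitaryGroup Literature.NumberTheory.Rogawski1990
open Literature.NumberTheory.GaloisRepresentations
open Summit.HodgeConjecture.HodgeConjecture.Cruxes.H413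
open Summit.HodgeConjecture.HodgeConjecture.Cruxes.H413.F0P3cStCharTSWeylCartanRadial
open Summit.HodgeConjecture.HodgeConjecture.Cruxes.H413.F0P3cStCharTSUpTrExchange
open scoped MatrixGroups Classical

namespace Summit.HodgeConjecture.HodgeConjecture.Cruxes.H413.F0P3cStCharTSEllInnerTorusExchange

/-! ## §1 Group algebra: centralisers of conjugates -/

section GroupAlgebra

variable {G : Type*} [Group G]

/-- Conjugation into a subgroup in membership letters composes: `(∀ g, g ∈ Z ↔ y⁻¹ g y ∈ T₀)` and `x = c z c⁻¹` with `Z_G(x) = T′`, `Z_G(z) = Z` give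
`∀ h, h ∈ T′ ↔ (c y)⁻¹ h (c y) ∈ T₀`. [folklore] -/
theorem forall_mem_iff_of_conj {T' T₀ Z : Subgroup G} {c y z : G}
    (hT' : Subgroup.centralizer ({c * z * c⁻¹} : Set G) = T') (hZ : Subgroup.centralizer ({z} : Set G) = Z)
    (hy : ∀ g : G, g ∈ Z ↔ y⁻¹ * g * y ∈ T₀) :
    ∀ h : G, h ∈ T' ↔ (c * y)⁻¹ * h * (c * y) ∈ T₀ := by
  intro h
  rw [← hT', F0P3cStCharTSUpTrCover.mem_centralizer_conj_iff, hZ, hy]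
  constructor <;> intro hh <;> · convert hh using 1; group

end GroupAlgebra

/-! ## §2 The fibre count `#{s ∈ T_H ∣ e s ∼ x}`: zero off `T₀`, the torsor on `T₀` -/

section Fibre

variable (L : Type) [Field L] [NumberField L] [IsCMField L] (v : HeightOneSpectrum (𝓞 ↥(maximalRealSubfield L)))

/-- **OFF the member `T₀` conjugate to `Z_G(γ)` the fibre is EMPTY**: for `T′ = Z_G(γ₀′) ≠ T₀` both in `Sell` (irredundant in Weyl-integration letters) and a REGULAR `x ∈ T′`,
no `e s` (`s ∈ T_H`) is conjugate to `x` — otherwise `T′ = Z_G(x) ∼ Z_G(e s) = Z_G(γ) ∼ T₀`. [cite: Rogawski1990, §12.5 p. 182; §3.6 p. 28] -/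
theorem ncard_setOf_isConj_apply_eq_zero_of_ne
    {A : Type*} [Group A] [TopologicalSpace A] (TH : Subgroup A)
    {γ : Gqs L v} (hγ : IsRegularElt (γ.val : GL (Fin 3) (UnitaryGroup.LocalRing L v)))
    (e : ↥TH ≃ₜ* ↥(Subgroup.centralizer ({γ} : Set (Gqs L v))))
    {T₀ T' : Subgroup (Gqs L v)} (y : Gqs L v) (hy : ∀ g : Gqs L v, g ∈ Subgroup.centralizer ({γ} : Set (Gqs L v)) ↔ y⁻¹ * g * y ∈ T₀)
    {γ₀' : Gqs L v} (hγ₀' : IsRegularElt (γ₀'.val : GL (Fin 3) (UnitaryGroup.LocalRing L v))) (hT' : T' = Subgroup.centralizer ({γ₀'} : Set (Gqs L v)))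
    (hnc : ∀ w : Gqs L v, ¬ ∀ h : Gqs L v, h ∈ T' ↔ w⁻¹ * h * w ∈ T₀)
    (x : ↥T') (hx : IsRegularElt (((x : Gqs L v)).val : GL (Fin 3) (UnitaryGroup.LocalRing L v))) :
    {s : ↥TH | IsConj ((e s : ↥(Subgroup.centralizer ({γ} : Set (Gqs L v)))) : Gqs L v) (x : Gqs L v)}.ncard = 0 := by
  suffices h0 : {s : ↥TH | IsConj ((e s : ↥(Subgroup.centralizer ({γ} : Set (Gqs L v)))) : Gqs L v) (x : Gqs L v)} = ∅ by
    rw [h0, Set.ncard_empty]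
  refine Set.eq_empty_of_forall_notMem fun s hs => ?_
  obtain ⟨c, hc⟩ := isConj_iff.1 hs
  set z : Gqs L v := ((e s : ↥(Subgroup.centralizer ({γ} : Set (Gqs L v)))) : Gqs L v) with hz
  -- `z` is regular (a conjugate of the regular `x`) and `Z_G(z) = Z_G(γ)`
  have hzreg : IsRegularElt (z.val : GL (Fin 3) (UnitaryGroup.LocalRing L v)) := by
    rw [← isRegularElt_conj_val_iff L v c z, hc]; exact hx
  have hZz : Subgroup.centralizer ({z} : Set (Gqs L v)) = Subgroup.centralizer ({γ} : Set (Gqs L v)) :=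
    centralizer_eq_of_mem_centralizer_of_isRegularElt L v hγ (e s).2 hzreg
  -- `Z_G(x) = T′`
  have hZx : Subgroup.centralizer ({c * z * c⁻¹} : Set (Gqs L v)) = T' := by
    rw [hc]; exact centralizer_eq_cartan_of_isRegularElt hγ₀' hT' x hx
  exact hnc (c * y) (forall_mem_iff_of_conj hZx hZz hy)

/-- **ON `T₀` the fibre of a regular `x ∈ T₀` is the TORSOR**: `#{s ∈ T_H ∣ e s ∼ x} = [N_G(T₀) : T₀]` — the bijection `s ↦ y⁻¹ (e s) y : T_H → T₀` carries the fibre onto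
`{t ∈ T₀ ∣ t ∼ x}`, counted by ★ (H6-T) `ncard_setOf_mem_isConj_eq_index` at `R = {regular}`. [cite: HarishChandra1970, Part V §4 Lemma 42] [cite: Rogawski1990, §12.5 p. 182] -/
theorem ncard_setOf_isConj_apply_eq_index
    {A : Type*} [Group A] [TopologicalSpace A] (TH : Subgroup A)
    {γ : Gqs L v} (e : ↥TH ≃ₜ* ↥(Subgroup.centralizer ({γ} : Set (Gqs L v))))
    {T₀ : Subgroup (Gqs L v)} (y : Gqs L v) (hy : ∀ g : Gqs L v, g ∈ Subgroup.centralizer ({γ} : Set (Gqs L v)) ↔ y⁻¹ * g * y ∈ T₀)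
    {γ₀ : Gqs L v} (hγ₀ : IsRegularElt (γ₀.val : GL (Fin 3) (UnitaryGroup.LocalRing L v))) (hT₀ : T₀ = Subgroup.centralizer ({γ₀} : Set (Gqs L v)))
    (x : ↥T₀) (hx : IsRegularElt (((x : Gqs L v)).val : GL (Fin 3) (UnitaryGroup.LocalRing L v))) :
    {s : ↥TH | IsConj ((e s : ↥(Subgroup.centralizer ({γ} : Set (Gqs L v)))) : Gqs L v) (x : Gqs L v)}.ncard =
      (T₀.subgroupOf (Subgroup.normalizer (T₀ : Set (Gqs L v)))).index := by
  -- the torsor count on `T₀` at the regular point `x`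
  have htor := Literature.GroupTheory.ncard_setOf_mem_isConj_eq_index T₀
    {g : Gqs L v | IsRegularElt (g.val : GL (Fin 3) (UnitaryGroup.LocalRing L v))}
    (fun t ht => centralizer_eq_cartan_of_isRegularElt hγ₀ hT₀ t ht) (fun g t ht => (isRegularElt_conj_val_iff L v g t).2 ht) x.2 hx
  rw [← htor]
  -- the bijection `s ↦ y⁻¹ (e s) y`
  set f : ↥TH → Gqs L v := fun s => y⁻¹ * ((e s : ↥(Subgroup.centralizer ({γ} : Set (Gqs L v)))) : Gqs L v) * y with hf
  have hfinj : Function.Injective f := by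
    intro s s' h
    have h' : ((e s : ↥(Subgroup.centralizer ({γ} : Set (Gqs L v)))) : Gqs L v) = ((e s' : ↥(Subgroup.centralizer ({γ} : Set (Gqs L v)))) : Gqs L v) := by
      have := congrArg (fun t => y * t * y⁻¹) h
      simpa [hf, mul_assoc] using this
    exact e.injective (Subtype.ext h')
  have himage : f '' {s : ↥TH | IsConj ((e s : ↥(Subgroup.centralizer ({γ} : Set (Gqs L v)))) : Gqs L v) (x : Gqs L v)} =
      {g : Gqs L v | g ∈ T₀ ∧ IsConj (x : Gqs L v) g} := by
    ext g
    simp only [Set.mem_image, Set.mem_setOf_eq]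
    constructor
    · rintro ⟨s, hs, rfl⟩
      refine ⟨(hy _).1 (e s).2, ?_⟩
      exact hs.symm.trans (isConj_iff.2 ⟨y⁻¹, by simp [hf]⟩)
    · rintro ⟨hgT, hxg⟩
      have hmem : y * g * y⁻¹ ∈ Subgroup.centralizer ({γ} : Set (Gqs L v)) := (hy _).2 (by rwa [show y⁻¹ * (y * g * y⁻¹) * y = g by group])
      refine ⟨e.symm ⟨y * g * y⁻¹, hmem⟩, ?_, ?_⟩
      · rw [ContinuousMulEquiv.apply_symm_apply]
        exact (isConj_iff.2 ⟨y, rfl⟩).symm.trans hxg.symm |>.symm |> fun h => by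
          -- `e s = y g y⁻¹ ∼ g ∼ x`
          exact (isConj_iff.2 ⟨y⁻¹, by group⟩ : IsConj (y * g * y⁻¹) g).trans hxg.symm
      · simp [hf, ContinuousMulEquiv.apply_symm_apply, mul_assoc]
  rw [← himage, Set.ncard_image_of_injective _ hfinj]

end Fibre

/-! ## §3 Transport: `∫_{T₀} Φ dμTf T₀ = ∫_{T_H} Φ ∘ e dtH` along `s ↦ y⁻¹ (e s) y` -/

section Transport

variable (L : Type) [Field L] [NumberField L] [IsCMField L] (v : HeightOneSpectrum (𝓞 ↥(maximalRealSubfield L)))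

/-- The conjugation `z ↦ y⁻¹ z y` is an isomorphism of topological groups `Z ≃ₜ* T₀` when `∀ g, g ∈ Z ↔ y⁻¹ g y ∈ T₀` (existence with its value formula; no
definition is introduced). [folklore] -/
theorem exists_conj_continuousMulEquiv [IsTopologicalGroup (Gqs L v)] {Z T₀ : Subgroup (Gqs L v)} (y : Gqs L v)
    (hy : ∀ g : Gqs L v, g ∈ Z ↔ y⁻¹ * g * y ∈ T₀) :
    ∃ c : ↥Z ≃ₜ* ↥T₀, ∀ z : ↥Z, ((c z : ↥T₀) : Gqs L v) = y⁻¹ * (z : Gqs L v) * y := by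
  refine ⟨{ toFun := fun z => ⟨y⁻¹ * (z : Gqs L v) * y, (hy _).1 z.2⟩
            invFun := fun t => ⟨y * (t : Gqs L v) * y⁻¹, (hy _).2 (by rw [show y⁻¹ * (y * (t : Gqs L v) * y⁻¹) * y = (t : Gqs L v) by group]; exact t.2)⟩
            left_inv := fun z => Subtype.ext (by simp [mul_assoc])
            right_inv := fun t => Subtype.ext (by simp [mul_assoc])
            map_mul' := fun z z' => Subtype.ext (by
              change y⁻¹ * ((z : Gqs L v) * (z' : Gqs L v)) * y = y⁻¹ * (z : Gqs L v) * y * (y⁻¹ * (z' : Gqs L v) * y)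
              group)
            continuous_toFun := ((continuous_const.mul continuous_subtype_val).mul continuous_const).subtype_mk _
            continuous_invFun := ((continuous_const.mul continuous_subtype_val).mul continuous_const).subtype_mk _ }, fun z => rfl⟩

/-- **`∫_{T₀} Φ dμTf T₀ = ∫_{T_H} Φ(e s) dtH(s)`** for a class function `Φ`: both Haar measures have mass one on the compact core, so `(conjEquiv ∘ e)_* tH = μTf T₀`
(★ (A1′)-D `map_continuousMulEquiv_eq_of_apply_compactCore_eq_one`), and `Φ(y⁻¹ (e s) y) = Φ(e s)`. [cite: Rogawski1990, §12.5 p. 183] [cite: LanglandsShelstad1987, §1.3] -/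
theorem integral_eq_integral_comp_of_conj_into [IsTopologicalGroup (Gqs L v)]
    [MeasurableSpace (Gqs L v)] [BorelSpace (Gqs L v)] [LocallyCompactSpace (Gqs L v)] [SecondCountableTopology (Gqs L v)] [T2Space (Gqs L v)]
    {A : Type*} [Group A] [TopologicalSpace A] [IsTopologicalGroup A] [MeasurableSpace A] [BorelSpace A] (TH : Subgroup A)
    (tH : Measure ↥TH) [tH.IsHaarMeasure] (htH : tH (compactCore ↥TH) = 1)
    {γ : Gqs L v} (e : ↥TH ≃ₜ* ↥(Subgroup.centralizer ({γ} : Set (Gqs L v))))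
    {T₀ : Subgroup (Gqs L v)} (y : Gqs L v) (hy : ∀ g : Gqs L v, g ∈ Subgroup.centralizer ({γ} : Set (Gqs L v)) ↔ y⁻¹ * g * y ∈ T₀)
    {γ₀ : Gqs L v} (hT₀ : T₀ = Subgroup.centralizer ({γ₀} : Set (Gqs L v)))
    (μ₀ : Measure ↥T₀) [μ₀.IsHaarMeasure] (hμ₀ : μ₀ (compactCore ↥T₀) = 1)
    (Φ : Gqs L v → ℂ) (hΦc : ∀ x z : Gqs L v, IsConj x z → Φ x = Φ z) :
    ∫ x : ↥T₀, Φ (x : Gqs L v) ∂μ₀ = ∫ s : ↥TH, Φ ((e s : ↥(Subgroup.centralizer ({γ} : Set (Gqs L v)))) : Gqs L v) ∂tH := by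
  obtain ⟨c, hc⟩ := exists_conj_continuousMulEquiv L v (Z := Subgroup.centralizer ({γ} : Set (Gqs L v))) y hy
  have hmap : Measure.map (e.trans c) tH = μ₀ := map_continuousMulEquiv_eq_of_apply_compactCore_eq_one L v TH hT₀ (e.trans c) tH htH μ₀ hμ₀
  rw [← hmap]
  refine (integral_map_equiv (e.trans c).toHomeomorph.toMeasurableEquiv (fun x : ↥T₀ => Φ (x : Gqs L v))).trans ?_
  refine integral_congr_ae (ae_of_all _ fun s => ?_)
  -- `Φ(y⁻¹ (e s) y) = Φ(e s)`
  show Φ (((e.trans c) s : ↥T₀) : Gqs L v) = Φ ((e s : ↥(Subgroup.centralizer ({γ} : Set (Gqs L v)))) : Gqs L v)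
  rw [ContinuousMulEquiv.trans_apply, hc]
  exact hΦc _ _ (isConj_iff.2 ⟨y, by group⟩)

end Transport

/-! ## §4 The head: the `(T, i)`-piece of (E0) «G-REGROUP» -/

section Head

variable (L : Type) [Field L] [NumberField L] [IsCMField L] (v : HeightOneSpectrum (𝓞 ↥(maximalRealSubfield L)))

/-- **(E0a) «TORUS EXCHANGE».**  `G = U(Φ₃)(L⁺_v)`, `v` non-split; `Sell`, `μTf` in ★ RUNG0 v8's letters (`hcartO`, `hncGO` restricted to `Sell`, `hHaarGO`, `hcoreGO`); `e : T_H ≃ₜ* Z_G(γ)`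
(`γ` regular) with `Z_G(γ)` conjugate into the member `T₀` (`hy`, ★ `hcovGO`'s letter); `tH` Haar on `T_H` with mass one on the compact core; `Φ` a conjugation-invariant function
on `G` vanishing off the regular set.  THEN  `Σ_{T′ ∈ Sell} ([N_G(T′):T′] : ℂ)⁻¹ · ∫_{x ∈ T′} #{s ∈ T_H ∣ e s ∼ x} · Φ x dμTf T′ = ∫_{T_H} Φ (e s) dtH`.
[cite: Rogawski1990, §12.5 pp. 182–184] [cite: HarishChandra1970, Part V §4 Lemma 42] [cite: LanglandsShelstad1987, §1.3] -/
theorem sum_invIndex_mul_integral_ncard_mul_eq_integral_comp [IsTopologicalGroup (Gqs L v)]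
    (hns : ∀ w : PlacesOver L v, IsCMField.complexConj L • w.1 = w.1)
    [MeasurableSpace (Gqs L v)] [BorelSpace (Gqs L v)] [LocallyCompactSpace (Gqs L v)] [SecondCountableTopology (Gqs L v)] [T2Space (Gqs L v)]
    {A : Type*} [Group A] [TopologicalSpace A] [IsTopologicalGroup A] [MeasurableSpace A] [BorelSpace A] (TH : Subgroup A)
    (tH : Measure ↥TH) [tH.IsHaarMeasure] (htH : tH (compactCore ↥TH) = 1)
    (Sell : Finset (Subgroup (Gqs L v))) (μTf : (T' : Subgroup (Gqs L v)) → Measure ↥T')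
    (hcartO : ∀ T ∈ Sell, IsCompact (T : Set (Gqs L v)) ∧
      ∃ γ₀ : Gqs L v, IsRegularElt (γ₀.val : GL (Fin 3) (UnitaryGroup.LocalRing L v)) ∧ T = Subgroup.centralizer ({γ₀} : Set (Gqs L v)))
    (hncG : ∀ T' ∈ Sell, ∀ T'' ∈ Sell, T' ≠ T'' → ∀ y : Gqs L v, ¬ ∀ h : Gqs L v, h ∈ T'' ↔ y⁻¹ * h * y ∈ T')
    (hHaarGO : ∀ T ∈ Sell, (μTf T).IsHaarMeasure) (hcoreGO : ∀ T' ∈ Sell, μTf T' (compactCore ↥T') = 1)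
    {γ : Gqs L v} (hγ : IsRegularElt (γ.val : GL (Fin 3) (UnitaryGroup.LocalRing L v)))
    (e : ↥TH ≃ₜ* ↥(Subgroup.centralizer ({γ} : Set (Gqs L v))))
    {T₀ : Subgroup (Gqs L v)} (hT₀ : T₀ ∈ Sell) (y : Gqs L v)
    (hy : ∀ g : Gqs L v, g ∈ Subgroup.centralizer ({γ} : Set (Gqs L v)) ↔ y⁻¹ * g * y ∈ T₀)
    (Φ : Gqs L v → ℂ) (hΦc : ∀ x z : Gqs L v, IsConj x z → Φ x = Φ z)
    (hΦ0 : ∀ x : Gqs L v, ¬ IsRegularElt (x.val : GL (Fin 3) (UnitaryGroup.LocalRing L v)) → Φ x = 0) :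
    ∑ T' ∈ Sell, (((T'.subgroupOf (Subgroup.normalizer (T' : Set (Gqs L v)))).index : ℂ))⁻¹ *
        ∫ x : ↥T', (({s : ↥TH | IsConj ((e s : ↥(Subgroup.centralizer ({γ} : Set (Gqs L v)))) : Gqs L v) (x : Gqs L v)}.ncard : ℂ) * Φ (x : Gqs L v)) ∂(μTf T') =
      ∫ s : ↥TH, Φ ((e s : ↥(Subgroup.centralizer ({γ} : Set (Gqs L v)))) : Gqs L v) ∂tH := by
  obtain ⟨-, γ₀, hγ₀, hT₀eq⟩ := hcartO T₀ hT₀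
  haveI : (μTf T₀).IsHaarMeasure := hHaarGO T₀ hT₀
  -- only the member `T₀` contributes
  rw [Finset.sum_eq_single_of_mem T₀ hT₀ (fun T' hT' hne => ?_)]
  · -- the `T₀` term: the count is the torsor `[N_G(T₀):T₀]` at every regular point, and `Φ = 0` elsewhere
    have hidx : (T₀.subgroupOf (Subgroup.normalizer (T₀ : Set (Gqs L v)))).index ≠ 0 := index_cartan_subgroupOf_normalizer_ne_zero hγ₀ hT₀eq hns
    have hpt : ∀ x : ↥T₀,
        ({s : ↥TH | IsConj ((e s : ↥(Subgroup.centralizer ({γ} : Set (Gqs L v)))) : Gqs L v) (x : Gqs L v)}.ncard : ℂ) * Φ (x : Gqs L v) =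
          ((T₀.subgroupOf (Subgroup.normalizer (T₀ : Set (Gqs L v)))).index : ℂ) * Φ (x : Gqs L v) := by
      intro x
      by_cases hx : IsRegularElt (((x : Gqs L v)).val : GL (Fin 3) (UnitaryGroup.LocalRing L v))
      · rw [ncard_setOf_isConj_apply_eq_index L v TH e y hy hγ₀ hT₀eq x hx]
      · rw [hΦ0 _ hx, mul_zero, mul_zero]
    rw [integral_congr_ae (ae_of_all _ hpt), integral_const_mul, ← mul_assoc, inv_mul_cancel₀ (Nat.cast_ne_zero.2 hidx), one_mul]
    exact integral_eq_integral_comp_of_conj_into L v TH tH htH e y hy hT₀eq (μTf T₀) (hcoreGO T₀ hT₀) Φ hΦc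
  · -- the other members: the fibre of every regular point is empty, and `Φ = 0` at the non-regular ones
    obtain ⟨-, γ₀', hγ₀', hT'eq⟩ := hcartO T' hT'
    have hpt : ∀ x : ↥T',
        ({s : ↥TH | IsConj ((e s : ↥(Subgroup.centralizer ({γ} : Set (Gqs L v)))) : Gqs L v) (x : Gqs L v)}.ncard : ℂ) * Φ (x : Gqs L v) = 0 := by
      intro x
      by_cases hx : IsRegularElt (((x : Gqs L v)).val : GL (Fin 3) (UnitaryGroup.LocalRing L v))
      · rw [ncard_setOf_isConj_apply_eq_zero_of_ne L v TH hγ e y hy hγ₀' hT'eq (hncG T₀ hT₀ T' hT' (Ne.symm hne)) x hx, Nat.cast_zero, zero_mul]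
      · rw [hΦ0 _ hx, mul_zero]
    rw [integral_congr_ae (ae_of_all _ hpt), integral_zero, mul_zero]

end Head

end Summit.HodgeConjecture.HodgeConjecture.Cruxes.H413.F0P3cStCharTSEllInnerTorusExchange
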